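import Literature.MathematicalPhysics.QuantumFieldTheory.Balaban1983to89.B8Thm2TorusKnitCubeCore

/-!
# `Balaban1983to89.B8Thm2T3FamilyBinderSharp` — M5.9 ASSEMBLY, FILE A15: file A14's consumer binder `hThm2_of_core` at the SHARPER VOLUME FLOOR
# `k₀ ≤ F.m + n` (★★OWNER ym3-torus question (q3), 2026-08-28), and the honest provenance of `k₀`

statement-level skeleton of published theorems with citation tags; proofs where landed; nothing here is a claim about the
Yang–Mills mass gap

T. Bałaban, *Spaces of regular gauge field configurations on a lattice and gauge fixing conditions*, Commun. Math. Phys. **99** (1985) 75–102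
[`Balaban1985RegularSpaces`, "[B8]"]: Thm 2 p. 83, (1.33)–(1.39) pp. 82–83, p. 77 (*«we admit the case where some domains Ω_j are equal to T_η»*).
T. Bałaban, *Propagators for lattice gauge theories in a background field*, Commun. Math. Phys. **99** (1985) 389–434 [`Balaban1985BackgroundPropagators`,
"[B9]"]: Thm 3.1 p. 397 (*«for M ≥ M₁»*), Thm 3.7 p. 409 and Thm 3.9 p. 413 (*«For M sufficiently large»*).  T. Bałaban, *Propagators and renormalization
transformations for lattice gauge theories. II*, Commun. Math. Phys. **96** (1984) 223–250 [`Balaban1984PropagatorsII`]: (2.1)–(2.4) p. 224, Lemma 2.1 p. 234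
(*«for RM satisfying (2.59)»*).  STATUS: published, refereed.

CITATION HEADER (lean-in-tree rule).  Cell `lit-balaban`, seat `lit-balaban-t2s-1` (gen 6), MODULE M5.9, file A15; sub-row G-B8-T2S «[B8] §3 Thm 2 TORUS
SUPPLIER» (R3 `stmt-QuantumFields-19200`, helper).  CONSUMED BY NAME: file A14 `B8Thm2TorusKnitCubeCore.thm2SetupSUAt_catalogued_exists_of_core` (general
endpoint, volume threshold `k + k₀ ≤ m + K`), file A13 `B8Thm2T3FamilyBinder.P_eq_PV`, `T3SectALandauChart.eta ∕ eta_pos`.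

WHY THIS FILE.  The consumer of record (ym3-torus EX knit, socket `hThm2S` in `Thm2SetupSUAt` currency, ruling (T-b) 2026-08-28T12:47Z) reads file A14's
`hThm2_of_core`, whose located volume floor is `k₀ ≤ F.m` (uniform in the scale index `n`).  File A14 §2's general endpoint is offered for `k + k₀ ≤ m + K`;
at the consumer's member `(F, n, K)` — `k = K − n` averaging levels on the torus of period `2L^{F.m + K}` — this reads EXACTLY `k₀ ≤ F.m + n`.  The owner's
question (q3) asked (a) whether a revision could carry this sharper floor and (b) whether `k₀` is an absolute numeral.  (a): THIS FILE, ★ `hThm2_of_core_sharp`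
(the floor placed after `n K`; the proof is A14 §3's with one `omega`).  (b): NO — by file A11 `B8Thm2TorusMemberCatalogue.exists_catalogue`, `k₀ = a + 3`
where `L^a ≥ 8` and `L·L^a = M ≥ M_L`, `M_L` being file A10's big-block threshold `exists_threshold_knitCubeGeometry` at the eleven analytic constants and the
chosen rates (print's qualitative «for M sufficiently large» ∕ «M ≥ M₁» ∕ «RM satisfying (2.59)» made explicit); so `k₀` is a definite natural number once `L`
and the analytic constants are fixed (`a ≥ 2` at `L = 5`, hence `k₀ ≥ 5` there), uniform in `F, n, K`, but not a universal numeral.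

WHAT THIS FILE PROVES (sorry-free; theorems only).
* ★★★★★★★ **`hThm2_of_core_sharp`** — file A14's `hThm2_of_core` VERBATIM except that `k₀ ≤ F.m` (before `n K`) becomes `k₀ ≤ F.m + n` (after `n < K`).
  (File A14's floor `k₀ ≤ F.m` is the special case `k₀ ≤ F.m ≤ F.m + n`.)

HONEST SCOPE.  Bookkeeping of one inequality; NO estimate of [B8]∕[B9] is proved; the core cube data (`KnitCubeCore`, owners p21 ∕ p33 ∕ p38 lineages) and the
(B)-lines (`B9P3PerAt`) stay DISPLAYED antecedents, inhabited by nothing here; `L ≥ 5` odd, `N = 2`, `d + 1 = 3`; count-neutral; N05 ∕ `stub_PV3A` NOT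
discharged; nothing continuum ∕ ℝ⁴ ∕ OS ∕ mass-gap ∕ Clay — the Yang–Mills mass gap is NOT proved.  No `sorry`, no `axiom`, no `… : Prop` fact, no `instance`,
no `notation`.  NEW file; nothing landed is modified.  Seat `lit-balaban-t2s-1` gen 6, 2026-08-28.
-/

noncomputable section

open scoped BigOperators

namespace Literature.MathematicalPhysics.QuantumFieldTheory.Balaban1983to89.B8Thm2T3FamilyBinderSharp

open Node00 B6KLevelCensusIndexV1 B9BackgroundsKLevelV1 B9Thm311ReadingCoords
open B7Prop1Explicit renaming Site → LSite
open B7Prop1Explicit (e)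
open B9GeoNormsKLevelV1 (geo9K)
open B6GlobalChartV1 (PV)
open B6Ineq2142KLevelV1 (β)
open B8Ineq132 (InAk)
open B8Thm2TorusLettersPerOfKnit (bgY)
open B8Thm2TorusKnitEstimatesOfMajorants (B9P3PerAt)
open B8Thm2TorusKnitMajorantsOfCubes (KnitCubeParams)
open B8Thm2TorusKnitCubeCore (KnitCubeCore thm2SetupSUAt_catalogued_exists_of_core)
open B8Thm2T3FamilyBinder (P_eq_PV)
open B7Prop2SpecialUnitary (specialUnitaryUnits)
open B8Thm2SetupTorus (Thm2SetupSUAt)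
open T3ContinuumYM3Torus (T3Family)
open T3SectALandauChart (eta eta_pos)
open scoped Matrix Matrix.Norms.L2Operator

variable {ℓ : ℕ} {hL : Odd (ℓ + 1) ∧ 1 < ℓ + 1} {b₀ b₁ : ℝ}

section BinderSharp

variable {hd₃ : 1 ≤ 2 + 1}
variable [instF : ∀ i : KIdx 2 ℓ hd₃ hL b₀ b₁, Fintype (geo9K i).Site] [∀ i : KIdx 2 ℓ hd₃ hL b₀ b₁, DecidableEq (geo9K i).Site]

/-- ★★★★★★★ **THE SAME BINDER AT THE SHARPER VOLUME FLOOR `k₀ ≤ F.m + n`** (★★OWNER ym3-torus (q3), 2026-08-28): file A14 §2's general endpoint is offered for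
`k + k₀ ≤ m + K`; at the consumer's member `(F, n, K)` (`k = K − n`, `m = F.m`) this is EXACTLY `k₀ ≤ F.m + n`, so the floor of `hThm2_of_core` (`k₀ ≤ F.m`,
uniform in `n`) is relaxed to `k₀ ≤ F.m + n`, placed after `n K`.  `k₀` is NOT an absolute numeral: `k₀ = a + 3` with `L^a ≥ 8` and `L^{a+1} ≥ M_L`, `M_L` the
big-block threshold of file A10 at the analytic constants (print's «for M sufficiently large» ∕ «M ≥ M₁» ∕ «RM satisfying (2.59)»), fixed once `L` and the eleven
constants are.  Antecedents displayed, inhabited by nothing here; no estimate of [B8]∕[B9] proved; `stub_PV3A` NOT discharged; the Yang–Mills mass gap is NOT proved.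
[cite: Balaban1985RegularSpaces, Thm 2 p.83; Balaban1985BackgroundPropagators, Thm 3.1 p.397 («for M ≥ M₁»), Thm 3.7 p.409, Thm 3.9 p.413 («For M sufficiently large»); Balaban1984PropagatorsII, (2.1)–(2.4) p.224, Lemma 2.1 p.234] -/
theorem hThm2_of_core_sharp (hℓ : 4 ≤ ℓ) (hb₀ : 0 < b₀) (hb₁ : b₀ ≤ b₁)
    {B₀ B₀β cB9 βH : ℝ} {len : LSite (2 + 1) → ℝ}
    (hB₀ : 0 < B₀) (hB : 2 ≤ 5 * ((2 + 1 : ℕ) : ℝ) * ((ℓ + 1 : ℕ) : ℝ) * B₀) (hcB9 : 0 < cB9)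
    {ι : Type} [Fintype ι] [DecidableEq ι] (b : Module.Basis ι ℝ (Matrix (Fin 2) (Fin 2) ℂ)) {M₂ : ℝ} (hM₂ : 0 ≤ M₂)
    (hrepr : ∀ (v : Matrix (Fin 2) (Fin 2) ℂ) (j : ι), |b.repr v j| ≤ M₂ * ‖v‖)
    {BG₀ δG₀ NG NG' AE Ac δc BC δC Nn κD : ℝ} (hBG₀ : 0 ≤ BG₀) (hδG₀ : 0 < δG₀) (hNG : 0 ≤ NG) (hNG' : 0 ≤ NG')
    (hAE : 0 ≤ AE) (hAc : 0 ≤ Ac) (hδc : 0 < δc) (hBC : 0 ≤ BC) (hδC : 0 < δC) (hNn : 0 ≤ Nn) (hκD : 0 ≤ κD) (Rr : ℝ) (Hp : Prop) :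
    letI : CStarAlgebra (Matrix (Fin 2) (Fin 2) ℂ) := {}
    ∃ θs ℓs Ds cL A δG δ₀ : ℝ, 0 < θs ∧ 0 < ℓs ∧ 0 < cL ∧ Ac ≤ A ∧ 0 < δG ∧ δG ≤ δc ∧ 0 < δ₀ ∧ δ₀ ≤ δC ∧
      ∀ θG ℓ₀ ℓ₁ Dsep : ℝ, 0 ≤ θG → θG ≤ θs → 0 ≤ ℓ₀ → ℓ₀ ≤ ℓs → 0 ≤ ℓ₁ → ℓ₁ ≤ ℓs → Ds ≤ Dsep →
        ∃ p : KnitCubeParams,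
          (p.BG₀ = BG₀ ∧ p.δG₀ = δG₀ ∧ p.NG = NG ∧ p.NG' = NG' ∧ p.AE = AE ∧ p.θG = θG ∧ p.A = A ∧ p.δG = δG ∧
            p.B₀ = BC ∧ p.δ₀ = δ₀ ∧ p.bb = 1 ∧ p.aD = 1 ∧ p.Nn = Nn ∧ p.κD = κD ∧ p.Dsep = Dsep ∧ p.ℓ₀ = ℓ₀ ∧ p.ℓ₁ = ℓ₁) ∧
        ∃ (k₀ : ℕ) (mem : ℤ → ℕ → KIdx 2 ℓ hd₃ hL b₀ b₁) (ιBm : ∀ P n, BlkY (mem P n) → IBondY (mem P n)) (B₁ B₂ c₁ : ℝ),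
          0 < B₁ ∧ 0 < B₂ ∧ 0 < c₁ ∧
          (∀ (m K n : ℕ), 1 ≤ n → n + k₀ ≤ m + K →
            (mem (((PV 2 ℓ m K hd₃ hL).sitesPerDir 0 : ℕ) : ℤ) n).m = m + K ∧ (mem (((PV 2 ℓ m K hd₃ hL).sitesPerDir 0 : ℕ) : ℤ) n).K = 0 ∧
            (mem (((PV 2 ℓ m K hd₃ hL).sitesPerDir 0 : ℕ) : ℤ) n).k = n + 1 ∧
            (mem (((PV 2 ℓ m K hd₃ hL).sitesPerDir 0 : ℕ) : ℤ) n).cf = (((ℓ + 1 : ℕ) : ℝ)) ^ (mem (((PV 2 ℓ m K hd₃ hL).sitesPerDir 0 : ℕ) : ℤ) n).k ∧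
            (∀ z : SiteY (mem (((PV 2 ℓ m K hd₃ hL).sitesPerDir 0 : ℕ) : ℤ) n), levY (mem (((PV 2 ℓ m K hd₃ hL).sitesPerDir 0 : ℕ) : ℤ) n) z = n) ∧
            ∀ t, β (mem (((PV 2 ℓ m K hd₃ hL).sitesPerDir 0 : ℕ) : ℤ) n).hN (mem (((PV 2 ℓ m K hd₃ hL).sitesPerDir 0 : ℕ) : ℤ) n).D
              (mem (((PV 2 ℓ m K hd₃ hL).sitesPerDir 0 : ℕ) : ℤ) n).hk (ιBm (((PV 2 ℓ m K hd₃ hL).sitesPerDir 0 : ℕ) : ℤ) n t) = t) ∧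
          ∀ F : T3Family, F.L = ℓ + 1 → ∀ (n K : ℕ), n < K → k₀ ≤ F.m + n →
            (∀ j, 1 ≤ j → j ≤ K - n → ∀ ⦃α₀ : ℝ⦄, 0 < α₀ → α₀ ≤ cL → ∀ U₀ : LSite (2 + 1) → Fin (2 + 1) → (Matrix (Fin 2) (Fin 2) ℂ)ˣ,
                (∀ x κ, U₀ x κ ∈ specialUnitaryUnits (Fin 2)) →
                (∀ (x : LSite (2 + 1)) (μ : Fin (2 + 1)), U₀ (x + (((PV 2 ℓ F.m K hd₃ hL).sitesPerDir 0 : ℕ) : ℤ) • e μ) = U₀ x) →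
                InAk (ℓ + 1) j (eta F n K) α₀ (fun _ => (Set.univ : Set (LSite (2 + 1)))) U₀ →
                Nonempty (KnitCubeCore (mem (((PV 2 ℓ F.m K hd₃ hL).sitesPerDir 0 : ℕ) : ℤ) j)
                  (bgY (mem (((PV 2 ℓ F.m K hd₃ hL).sitesPerDir 0 : ℕ) : ℤ) j) U₀) b (ιBm (((PV 2 ℓ F.m K hd₃ hL).sitesPerDir 0 : ℕ) : ℤ) j) Rr Hp p)) →
            (∀ m', m' ≤ K - n → ∀ ⦃α₀ : ℝ⦄, 0 < α₀ → α₀ ≤ cL → ∀ U₀ : LSite (2 + 1) → Fin (2 + 1) → (Matrix (Fin 2) (Fin 2) ℂ)ˣ,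
                (∀ x κ, U₀ x κ ∈ specialUnitaryUnits (Fin 2)) →
                (∀ (x : LSite (2 + 1)) (μ : Fin (2 + 1)), U₀ (x + (((PV 2 ℓ F.m K hd₃ hL).sitesPerDir 0 : ℕ) : ℤ) • e μ) = U₀ x) →
                InAk (ℓ + 1) m' (eta F n K) α₀ (fun _ => (Set.univ : Set (LSite (2 + 1)))) U₀ →
                B9P3PerAt (𝔸 := Matrix (Fin 2) (Fin 2) ℂ) (ℓ + 1) B₀ B₀β cB9 βH len (eta F n K) m' α₀ (((PV 2 ℓ F.m K hd₃ hL).sitesPerDir 0 : ℕ) : ℤ) U₀) →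
            ∃ (β₀ B₂' : ℝ) (len' : LSite (F.P K).d → ℝ),
              Thm2SetupSUAt (F.P K) 2 (K - n) (eta F n K) β₀ B₁ B₂' c₁ len' (fun _ => True) := by
  letI : CStarAlgebra (Matrix (Fin 2) (Fin 2) ℂ) := {}
  obtain ⟨θs, ℓs, Ds, cL, A, δG, δ₀, hθs, hℓs, hcL, hA, hδG, hδGc, hδ₀, hδ₀C, H⟩ :=
    thm2SetupSUAt_catalogued_exists_of_core (d := 2) (ℓ := ℓ) (hd := hd₃) (hL := hL) (b₀ := b₀) (b₁ := b₁) (len := len) (B₀β := B₀β)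
      (βH := βH) (by norm_num) (by norm_num) hℓ hb₀ hb₁ hB₀ hB hcB9 b hM₂ hrepr hBG₀ hδG₀ hNG hNG' hAE hAc hδc hBC hδC hNn hκD Rr Hp
  refine ⟨θs, ℓs, Ds, cL, A, δG, δ₀, hθs, hℓs, hcL, hA, hδG, hδGc, hδ₀, hδ₀C, fun θG ℓ₀ ℓ₁ Dsep h1 h2 h3 h4 h5 h6 h7 => ?_⟩
  obtain ⟨p, hspec, k₀, mem, ιBm, B₁, B₂, c₁, hB₁, hB₂, hc₁, hcat, hend⟩ := H θG ℓ₀ ℓ₁ Dsep h1 h2 h3 h4 h5 h6 h7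
  refine ⟨p, hspec, k₀, mem, ιBm, B₁, B₂, c₁, hB₁, hB₂, hc₁, hcat, fun F hF n K hnK hm han hb9 => ?_⟩
  have hT := hend F.m K (K - n) (eta F n K) (by omega) (by omega) (eta_pos F n K) han hb9
  rw [P_eq_PV (hd := hd₃) (hL := hL) F hF K]
  exact ⟨0, B₂, len, hT⟩

end BinderSharp

end Literature.MathematicalPhysics.QuantumFieldTheory.Balaban1983to89.B8Thm2T3FamilyBinderSharp

end
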